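import Summits.ResolutionOfSingularities.ResolutionOfSingularities.Theorems.FrobeniusClosingSteerEventualMonomial
import HarnessLib

/-!
# Crux `Steer` (stmt-ResolutionOfSingularities-16345), line `switching_dichotomy`: COMMON COORDINATES — two elements
# monomialize SIMULTANEOUSLY in one regular system of parameters; quadratic sequences from a member are the shifted sequence

OURS (campaign `res-hironaka`, rung L ★L-G4, slot W4.1, chain W4.1; seat `res-L0-w41-stub-4` g3; Theses-free helper for the
holder res-L0-w41-lead-1's line `switching_dichotomy` and for the hands on res-L0-w41-strat-1's S3 `EternalCyclesSS`
(«rebuild the canonical run from S1/S2 for invariants», tri-1 06:35:16Z); replaces the role of no printed item; NOT a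
statement of the manuscript under review [claim: Hironaka2017, status: under-review]; AI-produced, which is weaker than
expert review). Sequel of `FrobeniusClosingSteerEventualMonomial.lean` (E-1).

* **E-10a `seq_eq_shift`.** A quadratic sequence `R'` along `O` starting at a member `R' 0 = R M` IS the shifted
  sequence: `R' i = R (M + i)` (uniqueness of the quadratic transform along `O`). So the residual Φ4ᴸˢ's «along ANY quadratic
  sequence from `R M`» and the `het` test of `concl_of_phasesSSL` quantify over ONE sequence.
* **E-10b `exists_monomial_pair_along`.** Monomial forms of TWO elements in ONE part of a regular system of parameters persist
  to every later member in one common part (iterating the landed one-step lemma `stub_rsopMonomialStep`, which maps a whole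
  part at once).
* **E-10c `exists_common_monomial_of_stronglySwitching`.** Under strong switching and archimedeanity (rank one), two non-zero
  elements `b₁, b₂` of a member `R i₀` are, at some later member `R N`, BOTH monomials (times units) in ONE part `z` of a
  regular system of parameters of `R N` — common coordinates for comparing exponent vectors (radicand vs. partials,
  consecutive cycle data `μ_j`, …). Proof: E-1 for `b₁` (part `zA` at `N₁`); archimedean `(zA 0) ^ n / b₂` lies in a member by
  strong switching; transport the whole part `zA` forward (E-10b) and divide (`exists_monomial_of_mul_eq`).
[cite: HeinzerEtAl2015, Lemma 2.7] [cite: HeinzerEtAl2015, Prop. 4.4]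
-/

-- `Summit.<S>.<S>.…` duplicates the summit name by design (single-problem summit).
set_option linter.dupNamespace false

open IsLocalRing
open Literature.AlgebraicGeometry.Resolution

namespace Summit.ResolutionOfSingularities.ResolutionOfSingularities.Theorems.SwitchingDichotomy

namespace EventualMonomial

variable {k K : Type} [Field k] [Field K] [Algebra k K]

/-! ## E-10a · quadratic sequences from a member are the shifted sequence -/

/-- **E-10a · uniqueness of the continued sequence.** If `R'` is a sequence of quadratic transforms along `O` with
`R' 0 = R M`, and `R` is one too, then `R' i = R (M + i)` for all `i`. [cite: Cutkosky2014, §2.2] [folklore] -/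
theorem seq_eq_shift (O : ValuationSubring K) (R R' : ℕ → Subring K) (M : ℕ) (h0 : R' 0 = R M)
    (hR : ∀ i, IsQuadraticTransformAlong O (R i) (R (i + 1)))
    (hR' : ∀ i, IsQuadraticTransformAlong O (R' i) (R' (i + 1))) (i : ℕ) : R' i = R (M + i) := by
  induction i with
  | zero => simpa using h0
  | succ i ih =>
    have h₁ : IsQuadraticTransformAlong O (R (M + i)) (R' (i + 1)) := by
      have := hR' i
      rwa [ih] at this
    rw [Nat.add_succ]
    exact (hR (M + i)).unique h₁ ▸ rfl

/-! ## E-10b · monomial forms of a pair persist in one common part -/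

/-- **E-10b · transporting a pair of monomial forms.** If `b₁, b₂` are monomials times units in ONE part `z` of a regular
system of parameters of `R i₀`, then at every later member `R (i₀ + d)` they are monomials times units in one common
part. [cite: HeinzerEtAl2015, Lemma 2.7] [folklore] -/
theorem exists_monomial_pair_along (O : ValuationSubring K) (R : ℕ → Subring K) [hR : ∀ i, IsLocalRing (R i)]
    (hstep : ∀ i, IsQuadraticTransformAlong O (R i) (R (i + 1)))
    (hdom : ∀ i, SubringDominates (R i) O.toSubring) (i₀ : ℕ) (b₁ b₂ : K)
    (hx : ∃ (s : ℕ) (z : Fin s → R i₀), IsRsopPart z ∧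
      (∃ (e : Fin s → ℕ) (u : R i₀), IsUnit u ∧ b₁ = (∏ l, ((z l : R i₀) : K) ^ e l) * (u : K)) ∧
      (∃ (e : Fin s → ℕ) (u : R i₀), IsUnit u ∧ b₂ = (∏ l, ((z l : R i₀) : K) ^ e l) * (u : K)))
    (d : ℕ) :
    ∃ (s : ℕ) (z : Fin s → R (i₀ + d)), IsRsopPart z ∧
      (∃ (e : Fin s → ℕ) (u : R (i₀ + d)), IsUnit u ∧ b₁ = (∏ l, ((z l : R (i₀ + d)) : K) ^ e l) * (u : K)) ∧
      (∃ (e : Fin s → ℕ) (u : R (i₀ + d)), IsUnit u ∧ b₂ = (∏ l, ((z l : R (i₀ + d)) : K) ^ e l) * (u : K)) := by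
  classical
  induction d with
  | zero => exact hx
  | succ d ih =>
    obtain ⟨s, z, hz, ⟨e₁, u₁, hu₁, hb₁⟩, ⟨e₂, u₂, hu₂, hb₂⟩⟩ := ih
    obtain ⟨s₁, z₁, hz₁, H⟩ :=
      stub_rsopMonomialStep K O (R (i₀ + d)) (R (i₀ + d + 1)) (hdom _) (hstep _) s z hz
    choose e' u' hu' hzu' using H
    have hle : R (i₀ + d) ≤ R (i₀ + d + 1) := (hstep _).le
    -- a `z`-monomial times a unit is a `z₁`-monomial times a unit
    have transport : ∀ (e : Fin s → ℕ) (u : R (i₀ + d)), IsUnit u →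
        ∃ (e'' : Fin s₁ → ℕ) (u'' : R (i₀ + d + 1)), IsUnit u'' ∧
          (∏ l, ((z l : R (i₀ + d)) : K) ^ e l) * (u : K) =
            (∏ l, ((z₁ l : R (i₀ + d + 1)) : K) ^ e'' l) * (u'' : K) := by
      intro e u hu
      refine ⟨fun l => ∑ j, e j * e' j l, (∏ j, u' j ^ e j) * Subring.inclusion hle u,
        (IsUnit.prod_univ_iff.mpr fun j => (hu' j).pow _).mul (hu.map _), ?_⟩
      simp only [hzu', mul_pow]
      rw [Finset.prod_mul_distrib, prod_prod_pow_pow, mul_assoc]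
      push_cast
      simp only [Subring.coe_inclusion]
    obtain ⟨f₁, w₁, hw₁, h₁⟩ := transport e₁ u₁ hu₁
    obtain ⟨f₂, w₂, hw₂, h₂⟩ := transport e₂ u₂ hu₂
    exact ⟨s₁, z₁, hz₁, ⟨f₁, w₁, hw₁, hb₁.trans h₁⟩, ⟨f₂, w₂, hw₂, hb₂.trans h₂⟩⟩

/-! ## E-10c · common coordinates for two elements -/

/-- **E-10c · simultaneous monomialization.** Along the point sequence of a base regular at the centre, strongly switching
and archimedean on fractions of `A₀` (rank one): two non-zero elements `b₁, b₂` of a member `R i₀` are, at some later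
member `R N`, BOTH monomials times units in ONE part of a regular system of parameters of `R N`.
[cite: HeinzerEtAl2015, Prop. 4.4] [folklore] -/
theorem exists_common_monomial_of_stronglySwitching (O : ValuationSubring K) (A₀ : Subalgebra k K)
    (h₀ : A₀.toSubring ≤ O.toSubring)
    (hreg : IsRegularLocalRing (Localization.AtPrime
      (Ideal.comap (Subring.inclusion h₀) (IsLocalRing.maximalIdeal O))))
    (R : ℕ → Subring K) (hR0 : R 0 = locAtCentre A₀.toSubring O)
    (hstep : ∀ i, IsQuadraticTransformAlong O (R i) (R (i + 1)))
    (hSS : ∀ x : K, x ∈ O → (∃ y ∈ A₀, ∃ z ∈ A₀, z ≠ 0 ∧ x = y / z) → ∃ i, x ∈ R i)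
    (hArch : ∀ x y : K, (∃ a ∈ A₀, ∃ b ∈ A₀, b ≠ 0 ∧ x = a / b) →
      (∃ a ∈ A₀, ∃ b ∈ A₀, b ≠ 0 ∧ y = a / b) → y ≠ 0 → O.valuation x < 1 →
      ∃ n : ℕ, O.valuation x ^ n < O.valuation y)
    (i₀ : ℕ) (b₁ b₂ : K) (hb₁ : b₁ ∈ R i₀) (hb₁0 : b₁ ≠ 0) (hb₂ : b₂ ∈ R i₀) (hb₂0 : b₂ ≠ 0) :
    ∃ N : ℕ, i₀ ≤ N ∧ ∃ (_ : IsLocalRing (R N)) (s : ℕ) (z : Fin s → R N), IsRsopPart z ∧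
      (∃ (e : Fin s → ℕ) (u : R N), IsUnit u ∧ b₁ = (∏ l, ((z l : R N) : K) ^ e l) * (u : K)) ∧
      (∃ (e : Fin s → ℕ) (u : R N), IsUnit u ∧ b₂ = (∏ l, ((z l : R N) : K) ^ e l) * (u : K)) := by
  classical
  -- facts along the sequence
  have hreg₀ : IsRegularLocalRing (R 0) := by
    rw [hR0]
    exact (isRegularLocalRing_locAtCentre_iff h₀).mpr hreg
  haveI hRreg : ∀ i, IsRegularLocalRing (R i) := isRegularLocalRing_sequence hreg₀ hstep
  have hdom₀ : SubringDominates (R 0) O.toSubring := by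
    rw [hR0]
    exact subringDominates_locAtCentre h₀
  have hRdom : ∀ i, SubringDominates (R i) O.toSubring := fun i =>
    (sequence_dominates hdom₀ hstep i).1
  have hmono : Monotone R := sequence_monotone hstep
  have hRO : ∀ i, R i ≤ O.toSubring := fun i => (hRdom i).1
  have hmax : ∀ i (a : R i), a ∈ maximalIdeal (R i) ↔ O.valuation (a : K) < 1 := fun i =>
    (subringDominates_valuationSubring_iff (hRO i)).mp (hRdom i)
  have hF0 : R 0 ≤ (Subfield.closure ((A₀.toSubring : Subring K) : Set K)).toSubring := by
    rw [hR0]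
    exact locAtCentre_le_subfield O fun x hx => Subfield.subset_closure hx
  have hRfrac : ∀ i, ∀ x ∈ R i, ∃ y ∈ A₀, ∃ z ∈ A₀, z ≠ 0 ∧ x = y / z := fun i x hx => by
    obtain ⟨y, hy, z, hz, hz0, hxyz⟩ :=
      exists_div_eq_of_mem_subfieldClosure (sequence_le_subfield hF0 hstep i hx)
    exact ⟨y, hy, z, hz, hz0, hxyz⟩
  -- E-1 for `b₁`: a part `zA` at `N₁`
  obtain ⟨N₁, hN₁, hloc₁, s₁, zA, hzA, e₁, u₁, hu₁, hbe₁⟩ :=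
    exists_monomial_of_stronglySwitching O A₀ h₀ hreg R hR0 hstep hSS hArch i₀ b₁ hb₁ hb₁0
  have hb₂N₁ : b₂ ∈ R N₁ := hmono hN₁ hb₂
  -- a regular parameter `x₀` inside a part containing `zA`: enlarge `zA` by nothing if non-empty, else use a
  -- one-element part; in both cases we get ONE part `w` of `R N₁` monomializing `b₁` with a member `w 0` of value `< 1`
  obtain ⟨s, w, hw, hwpos, e₁', u₁', hu₁', hbe₁'⟩ : ∃ (s : ℕ) (w : Fin (s + 1) → R N₁), IsRsopPart w ∧
      O.valuation ((w 0 : R N₁) : K) < 1 ∧ ∃ (e : Fin (s + 1) → ℕ) (u : R N₁), IsUnit u ∧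
        b₁ = (∏ l, ((w l : R N₁) : K) ^ e l) * (u : K) := by
    cases s₁ with
    | zero =>
      -- `b₁` is a unit; take any one-element part
      have hne : maximalIdeal (R N₁) ≠ ⊥ := by
        obtain ⟨hloc, x₀, hx₀m, hx₀0, -, -⟩ := (hstep N₁).exists_eq_locAtCentre
        intro hbot
        have hx₀m' : x₀ ∈ maximalIdeal (R N₁) := by convert hx₀m
        rw [hbot, Ideal.mem_bot] at hx₀m'
        exact hx₀0 hx₀m'
      obtain ⟨w, hw⟩ := exists_isRsopPart_one hne
      refine ⟨0, w, hw, (hmax N₁ _).mp (hw.mem_maximalIdeal 0), fun _ => 0, u₁, hu₁, ?_⟩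
      rw [hbe₁]
      simp
    | succ s =>
      exact ⟨s, zA, hzA, (hmax N₁ _).mp (hzA.mem_maximalIdeal 0), e₁, u₁, hu₁, hbe₁⟩
  have hw0K : ((w 0 : R N₁) : K) ≠ 0 := fun h => hw.ne_zero 0 (Subtype.ext h)
  -- `b₂` is a unit at `N₁`: done at `N₁` with the part `w`
  by_cases hvb : O.valuation b₂ < 1
  swap
  · have hvb1 : O.valuation b₂ = 1 :=
      le_antisymm ((O.valuation_le_one_iff b₂).mpr (hRO N₁ hb₂N₁)) (not_lt.mp hvb)
    refine ⟨N₁, hN₁, inferInstance, s + 1, w, hw, ⟨e₁', u₁', hu₁', hbe₁'⟩, fun _ => 0, ⟨b₂, hb₂N₁⟩, ?_, by simp⟩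
    rw [isUnit_subring_iff_inv_mem]
    exact ⟨hb₂0, (hRdom N₁).2 b₂ hb₂N₁ ((O.valuation_le_one_iff _).mp (by
      rw [map_inv₀, hvb1, inv_one]))⟩
  -- the archimedean step for `b₂` with the parameter `w 0`
  obtain ⟨n, hn⟩ := hArch _ b₂ (hRfrac N₁ _ (w 0).2) (hRfrac N₁ b₂ hb₂N₁) hb₂0 hwpos
  have hvc : O.valuation (((w 0 : R N₁) : K) ^ n / b₂) < 1 := by
    rw [map_div₀, map_pow, div_lt_one₀ ((Valuation.pos_iff _).mpr hb₂0)]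
    exact hn
  have hcO : ((w 0 : R N₁) : K) ^ n / b₂ ∈ O := (O.valuation_le_one_iff _).mp hvc.le
  have hcfrac : ∃ y ∈ A₀, ∃ z ∈ A₀, z ≠ 0 ∧ ((w 0 : R N₁) : K) ^ n / b₂ = y / z := by
    obtain ⟨y₁, hy₁, v₁, hv₁, hv₁0, h₁⟩ := hRfrac N₁ _ (w 0).2
    obtain ⟨y₂, hy₂, v₂, hv₂, hv₂0, h₂⟩ := hRfrac N₁ b₂ hb₂N₁
    have hy₂0 : y₂ ≠ 0 := by
      rintro rfl
      exact hb₂0 (by rw [h₂, zero_div])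
    refine ⟨y₁ ^ n * v₂, A₀.mul_mem (pow_mem hy₁ n) hv₂, v₁ ^ n * y₂,
      A₀.mul_mem (pow_mem hv₁ n) hy₂, mul_ne_zero (pow_ne_zero n hv₁0) hy₂0, ?_⟩
    rw [h₁, h₂, div_pow, div_div_eq_mul_div, div_mul_eq_mul_div, div_div]
  obtain ⟨N₂, hcN₂⟩ := hSS _ hcO hcfrac
  -- transport the pair (`b₁`, `w 0`) in the part `w` from `N₁` to `N := N₁ + N₂`
  have hpair : ∃ (s' : ℕ) (z : Fin s' → R N₁), IsRsopPart z ∧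
      (∃ (e : Fin s' → ℕ) (u : R N₁), IsUnit u ∧ b₁ = (∏ l, ((z l : R N₁) : K) ^ e l) * (u : K)) ∧
      (∃ (e : Fin s' → ℕ) (u : R N₁), IsUnit u ∧
        ((w 0 : R N₁) : K) = (∏ l, ((z l : R N₁) : K) ^ e l) * (u : K)) :=
    ⟨s + 1, w, hw, ⟨e₁', u₁', hu₁', hbe₁'⟩, ⟨Pi.single 0 1, 1, isUnit_one, by
      rw [Finset.prod_eq_single (0 : Fin (s + 1)) (fun l _ hl => by rw [Pi.single_eq_of_ne hl, pow_zero])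
        (fun h => absurd (Finset.mem_univ _) h), Pi.single_eq_same, pow_one, OneMemClass.coe_one, mul_one]⟩⟩
  obtain ⟨s', zN, hzN, ⟨f₁, w₁, hw₁, hb₁N⟩, ⟨f₀, w₀, hw₀, hx₀N⟩⟩ :=
    exists_monomial_pair_along O R hstep hRdom N₁ b₁ _ hpair N₂
  have hcN : ((w 0 : R N₁) : K) ^ n / b₂ ∈ R (N₁ + N₂) := hmono (Nat.le_add_left N₂ N₁) hcN₂
  have hb₂N : b₂ ∈ R (N₁ + N₂) := hmono (Nat.le_add_right N₁ N₂) hb₂N₁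
  -- `b₂ · c = (w 0) ^ n` is a `zN`-monomial times a unit, hence so is `b₂`
  have hbc : b₂ * (((w 0 : R N₁) : K) ^ n / b₂) =
      (∏ l, ((zN l : R (N₁ + N₂)) : K) ^ (n * f₀ l)) * ((w₀ ^ n : R (N₁ + N₂)) : K) := by
    rw [mul_div_cancel₀ _ hb₂0, hx₀N, mul_pow, ← Finset.prod_pow, SubmonoidClass.coe_pow]
    refine congrArg (· * _) (Finset.prod_congr rfl fun l _ => ?_)
    rw [← pow_mul, mul_comm]
  obtain ⟨m, u', hu', hbm⟩ :=
    exists_monomial_of_mul_eq hzN (fun l => n * f₀ l) hb₂N hcN (hw₀.pow n) hbc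
  exact ⟨N₁ + N₂, hN₁.trans (Nat.le_add_right N₁ N₂), inferInstance, s', zN, hzN, ⟨f₁, w₁, hw₁, hb₁N⟩,
    ⟨m, u', hu', hbm⟩⟩

end EventualMonomial

end Summit.ResolutionOfSingularities.ResolutionOfSingularities.Theorems.SwitchingDichotomy
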